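import Summits.FinalStateConjecture.FinalStateConjecture.Theorems.EIHFluxBalanceModulatedKerrHandoffOneHoleDifference
import Summits.FinalStateConjecture.FinalStateConjecture.Theorems.EIHFluxBalanceModulatedKerrHandoffOneHoleClock
import Summits.FinalStateConjecture.FinalStateConjecture.Theorems.EIHFluxBalanceModulatedKerrHandoffOneHoleModuli

/-!
# Route EIHFluxBalance — `ModulatedKerrHandoff`, stub `stub_oneHoleMatching`: sizes of the parameter maps

Helper file for the crux `stmt-FinalStateConjecture-10167`
(`Summit.FinalStateConjecture.FinalStateConjecture.Theses.EIHFluxBalance.ModulatedKerrHandoff`),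
line `photon-rocket-modulation`, stub `stub_oneHoleMatching` (one-hole profile matching).

The two profiles are `ε • 𝔉 ∘ p₁` and `ε • 𝔉 ∘ p₀` with parameter maps
`p₁(y) = (Mf(U y), Λ(U y)⁻¹, εa, ε S Λ(U y)⁻¹(y − c(U y)))` (retarded) and
`p₀(y) = (M, Λ(y⁰)⁻¹, εa, ε S Λ(y⁰)⁻¹(y − c(y⁰)))` (instantaneous). This file bounds, at a base
point `x`, the positive-order `C³` sizes of such maps and the full `C³` size of their difference, in
terms of pointwise sizes of the moduli paths read on the clock `τ ∈ {U, y ↦ y⁰}`: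

* `ck₁_scaledPosition` — the scaled rest-frame position `y ↦ ε(S Λ(τ y)⁻¹ y − b(τ y))`
  (`b = S Λ⁻¹ c`, the rest-frame offset of the centre): the LARGE factor `‖x‖` multiplies only
  derivatives of the frame (refined Leibniz, `OneHole.norm_iteratedFDeriv_clm_apply_le_of_pos`);
* `ck_scaledPosition_sub` — its retarded-minus-instantaneous difference from the sizes of
  `y ↦ Λ(U y)⁻¹ − Λ(y⁰)⁻¹` and `y ↦ b(U y) − b(y⁰)`;
* `norm_sub_le_of_deriv_le_Icc` — order zero of such differences by the mean value inequality along
  the clock interval `[U x, x⁰]`;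
* `ck_pathDefect` — the full `C³` size of `y ↦ f(U y) − f(y⁰)` for a path `f` whose derivatives of
  orders `1 … 3` are small on `[U x, x⁰]` (tameness): order zero by the mean value inequality, higher
  orders because BOTH compositions have small derivatives (`OneHole.ck₁_comp_of_ck₁`);
* the data of one hole (`rin_pos`, `one_le_gamma`, `A_nonneg`, `abs_mass_le`) and the TAME sizes of
  the moduli read on the clock: `tame_restOffset_Icc`, the mass defect at the monopole rate
  (`tame_ck_massDefect`), the frame defect (`tame_ck_thetaDefect`) and the offset defect
  (`tame_ck_offsetDefect`).
-/

noncomputable section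

-- `Summit.<S>.<S>.…` (single-problem summit, D-0017) trips core's duplicate-namespace linter.
set_option linter.dupNamespace false

open Set Filter Function Literature.Geometry.Lorentzian
open scoped Topology ContDiff

namespace Summit.FinalStateConjecture.FinalStateConjecture.Theorems

namespace OneHole

variable {F : Type*} [NormedAddCommGroup F] [NormedSpace ℝ F]

/-! ### The scaled rest-frame position -/

/-- **Positive-order size of the scaled rest-frame position.** For a clock `τ` (positive-order size
`≤ D_τ`, `D_τ ≥ 1`), a frame path `θ` with `‖θ(τ x)‖ ≤ L₀` and derivatives of orders `1 … 3` at `τ x`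
of size `≤ η_θ`, and an offset path `b` with derivatives of orders `1 … 3` at `τ x` of size `≤ η_b`:
the map `y ↦ ε(S θ(τ y) y − b(τ y))` has derivatives of orders `1 … 3` at `x` of size
`≤ ε (6 η_θ D_τ³ ‖x‖ + 8 (L₀ + 6 η_θ D_τ³) + 6 η_b D_τ³)`. [folklore] -/
theorem ck₁_scaledPosition {θp : ℝ → E4 →L[ℝ] E4} {bp : ℝ → E3} {τ : E4 → ℝ} {x : E4}
    {L₀ ηθ ηb Dτ ε : ℝ}
    (hτ : ContDiffAt ℝ 3 τ x ∧ ∀ i, 1 ≤ i → i ≤ 3 → ‖iteratedFDeriv ℝ i τ x‖ ≤ Dτ) (hD : 1 ≤ Dτ)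
    (hθ0 : ‖θp (τ x)‖ ≤ L₀)
    (hθ : ContDiffAt ℝ 3 θp (τ x) ∧ ∀ i, 1 ≤ i → i ≤ 3 → ‖iteratedFDeriv ℝ i θp (τ x)‖ ≤ ηθ)
    (hb : ContDiffAt ℝ 3 bp (τ x) ∧ ∀ i, 1 ≤ i → i ≤ 3 → ‖iteratedFDeriv ℝ i bp (τ x)‖ ≤ ηb)
    (hε : 0 < ε) :
    ContDiffAt ℝ 3 (fun y ↦ ε • (E4.spatial (θp (τ y) y) - bp (τ y))) x ∧
      ∀ i, 1 ≤ i → i ≤ 3 →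
        ‖iteratedFDeriv ℝ i (fun y ↦ ε • (E4.spatial (θp (τ y) y) - bp (τ y))) x‖ ≤
          ε * (6 * ηθ * Dτ ^ 3 * ‖x‖ + 8 * (L₀ + 6 * ηθ * Dτ ^ 3) + 6 * ηb * Dτ ^ 3) := by
  have hηθ : 0 ≤ ηθ := (norm_nonneg _).trans (hθ.2 1 le_rfl (by norm_num))
  have hηb : 0 ≤ ηb := (norm_nonneg _).trans (hb.2 1 le_rfl (by norm_num))
  have hL₀ : 0 ≤ L₀ := (norm_nonneg _).trans hθ0
  have hD1 : max 1 Dτ = Dτ := max_eq_right hD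
  -- the frame on the clock
  have hθτ₁ := ck₁_comp_of_ck₁ hθ hτ
  rw [max_eq_left hηθ, hD1, show (Nat.factorial 3 : ℝ) = 6 by norm_num] at hθτ₁
  have hθτ : ContDiffAt ℝ 3 (fun y ↦ θp (τ y)) x ∧
      ∀ i ≤ 3, ‖iteratedFDeriv ℝ i (fun y ↦ θp (τ y)) x‖ ≤ L₀ + 6 * ηθ * Dτ ^ 3 :=
    ck_mono (ck_of_ck₁ hθτ₁ hθ0) le_rfl (max_le (by nlinarith [pow_nonneg (zero_le_one.trans hD) 3])
      (by linarith))
  -- the frame applied to the point: refined Leibniz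
  have hA : ContDiffAt ℝ 3 (fun y ↦ θp (τ y) y) x ∧
      ∀ i, 1 ≤ i → i ≤ 3 → ‖iteratedFDeriv ℝ i (fun y ↦ θp (τ y) y) x‖ ≤
        6 * ηθ * Dτ ^ 3 * ‖x‖ + 8 * (L₀ + 6 * ηθ * Dτ ^ 3) := by
    refine ⟨hθτ.1.clm_apply contDiffAt_id, fun i hi1 hi ↦ ?_⟩
    have h := norm_iteratedFDeriv_clm_apply_le_of_pos hθτ (ck₁_id 3 x) hi1 hi
    refine h.trans (add_le_add (mul_le_mul_of_nonneg_right (hθτ₁.2 i hi1 hi) (norm_nonneg _)) ?_)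
    have h2 : (2 : ℝ) ^ i ≤ 8 := by interval_cases i <;> norm_num
    have h0 : 0 ≤ L₀ + 6 * ηθ * Dτ ^ 3 := ck_nonneg hθτ
    nlinarith
  have hSA := ck₁_clm_comp_left hA (E4.spatial : E4 →L[ℝ] E3)
  -- the offset on the clock
  have hbτ := ck₁_comp_of_ck₁ hb hτ
  rw [max_eq_left hηb, hD1, show (Nat.factorial 3 : ℝ) = 6 by norm_num] at hbτ
  have hdiff := ck₁_const_smul (ck₁_sub hSA hbτ) ε
  rw [abs_of_pos hε] at hdiff
  refine ⟨hdiff.1, fun i hi1 hi ↦ (hdiff.2 i hi1 hi).trans (mul_le_mul_of_nonneg_left ?_ hε.le)⟩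
  have h0 : 0 ≤ 6 * ηθ * Dτ ^ 3 * ‖x‖ + 8 * (L₀ + 6 * ηθ * Dτ ^ 3) := by
    have := norm_nonneg x; have := pow_nonneg (zero_le_one.trans hD) 3; positivity
  nlinarith [norm_spatial_le]

/-- **Full size of the retarded-minus-instantaneous scaled position.** If
`Θ(y) = Λ(U y)⁻¹ − Λ(y⁰)⁻¹` has full `C³` size `≤ μ` at `x` and `B(y) = b(U y) − b(y⁰)` has full `C³`
size `≤ μ_b`, then `y ↦ ε(S Θ(y) y − B(y))` has full `C³` size `≤ ε (μ ‖x‖ + 8 μ + μ_b)` (refined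
Leibniz: `‖x‖` multiplies only derivatives of `Θ`). [folklore] -/
theorem ck_scaledPosition_sub {Θd : E4 → E4 →L[ℝ] E4} {Bd : E4 → E3} {x : E4} {μ μb ε : ℝ}
    (hΘ : ContDiffAt ℝ 3 Θd x ∧ ∀ i ≤ 3, ‖iteratedFDeriv ℝ i Θd x‖ ≤ μ)
    (hB : ContDiffAt ℝ 3 Bd x ∧ ∀ i ≤ 3, ‖iteratedFDeriv ℝ i Bd x‖ ≤ μb) (hε : 0 < ε) :
    ContDiffAt ℝ 3 (fun y ↦ ε • (E4.spatial (Θd y y) - Bd y)) x ∧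
      ∀ i ≤ 3, ‖iteratedFDeriv ℝ i (fun y ↦ ε • (E4.spatial (Θd y y) - Bd y)) x‖ ≤
        ε * (μ * ‖x‖ + 8 * μ + μb) := by
  have hμ : 0 ≤ μ := ck_nonneg hΘ
  have hA : ContDiffAt ℝ 3 (fun y ↦ Θd y y) x ∧
      ∀ i ≤ 3, ‖iteratedFDeriv ℝ i (fun y ↦ Θd y y) x‖ ≤ μ * ‖x‖ + 8 * μ := by
    refine ⟨hΘ.1.clm_apply contDiffAt_id, fun i hi ↦ ?_⟩
    rcases Nat.eq_zero_or_pos i with rfl | hi1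
    · rw [norm_iteratedFDeriv_zero]
      refine ((Θd x).le_opNorm x).trans ?_
      have h0 := hΘ.2 0 (Nat.zero_le _)
      rw [norm_iteratedFDeriv_zero] at h0
      nlinarith [norm_nonneg x]
    · have h := norm_iteratedFDeriv_clm_apply_le_of_pos hΘ (ck₁_id 3 x) hi1 hi
      refine h.trans (add_le_add (mul_le_mul_of_nonneg_right (hΘ.2 i hi) (norm_nonneg _)) ?_)
      have h2 : (2 : ℝ) ^ i ≤ 8 := by interval_cases i <;> norm_num
      nlinarith
  have hSA := ck_clm_comp_left hA (E4.spatial : E4 →L[ℝ] E3)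
  have hdiff := ck_const_smul (ck_sub hSA hB) ε
  rw [abs_of_pos hε] at hdiff
  refine ck_mono hdiff le_rfl (mul_le_mul_of_nonneg_left ?_ hε.le)
  have h0 : 0 ≤ μ * ‖x‖ + 8 * μ := by positivity
  nlinarith [norm_spatial_le]

/-! ### Differences of a path read on the two clocks -/

/-- **Mean value inequality along the clock interval**: for a differentiable path `f` with
`‖f′(s)‖ ≤ C` on `[U, t]` (`U ≤ t`), `‖f U − f t‖ ≤ C (t − U)`. [folklore] -/
theorem norm_sub_le_of_deriv_le_Icc {f : ℝ → F} (hf : Differentiable ℝ f) {U t C : ℝ} (hUt : U ≤ t)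
    (h : ∀ s ∈ Icc U t, ‖deriv f s‖ ≤ C) : ‖f U - f t‖ ≤ C * (t - U) := by
  have h1 := Convex.norm_image_sub_le_of_norm_deriv_le (𝕜 := ℝ) (f := f) (s := Icc U t)
    (fun s _ ↦ hf s) h (convex_Icc U t) (right_mem_Icc.mpr hUt) (left_mem_Icc.mpr hUt)
  rwa [Real.norm_eq_abs, abs_of_nonpos (by linarith), neg_sub] at h1

/-- **Full size of a path defect `y ↦ f(U y) − f(y⁰)`.** If `f` is smooth with `‖f⁽ᵏ⁾(s)‖ ≤ η` for
`1 ≤ k ≤ 3` and all `s ∈ [U x, x⁰]`, and the clock `U` has positive-order size `≤ D_U` (`D_U ≥ 1`) at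
`x` with `U x ≤ x⁰`, then the defect has full `C³` size `≤ η ((x⁰ − U x) + 12 D_U³)` at `x`.
[folklore] -/
theorem ck_pathDefect {f : ℝ → F} {Uc : E4 → ℝ} {x : E4} {η DU : ℝ} (hf : ContDiff ℝ ∞ f)
    (hU : ContDiffAt ℝ 3 Uc x ∧ ∀ i, 1 ≤ i → i ≤ 3 → ‖iteratedFDeriv ℝ i Uc x‖ ≤ DU) (hD : 1 ≤ DU)
    (hUt : Uc x ≤ x 0)
    (hη : ∀ s ∈ Icc (Uc x) (x 0), ∀ k, 1 ≤ k → k ≤ 3 → ‖iteratedDeriv k f s‖ ≤ η) :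
    ContDiffAt ℝ 3 (fun y ↦ f (Uc y) - f (y 0)) x ∧
      ∀ i ≤ 3, ‖iteratedFDeriv ℝ i (fun y ↦ f (Uc y) - f (y 0)) x‖ ≤ η * ((x 0 - Uc x) + 12 * DU ^ 3) := by
  have hUmem : Uc x ∈ Icc (Uc x) (x 0) := left_mem_Icc.mpr hUt
  have htmem : x 0 ∈ Icc (Uc x) (x 0) := right_mem_Icc.mpr hUt
  have hη0 : 0 ≤ η := (norm_nonneg _).trans (hη _ hUmem 1 le_rfl (by norm_num))
  have hf3 : ∀ s, ContDiffAt ℝ 3 f s := fun s ↦ (hf.of_le (WithTop.coe_le_coe.mpr le_top)).contDiffAt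
  have hD1 : max 1 DU = DU := max_eq_right hD
  -- the two compositions have small positive-order derivatives
  have h1 := ck₁_comp_of_ck₁ (ck₁_of_iteratedDeriv (hf3 (Uc x)) (hη _ hUmem)) hU
  have h0 := ck₁_comp_of_ck₁ (g := f) (f := fun y : E4 ↦ y 0) (x := x)
    (ck₁_of_iteratedDeriv (hf3 (x 0)) (hη _ htmem))
    (ck₁_mono (ck₁_clm 3 (EuclideanSpace.proj (0 : Fin 4) : E4 →L[ℝ] ℝ) x) le_rfl norm_dt_le)
  rw [max_eq_left hη0, hD1, show (Nat.factorial 3 : ℝ) = 6 by norm_num] at h1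
  rw [max_eq_left hη0, max_self, one_pow, mul_one, show (Nat.factorial 3 : ℝ) = 6 by norm_num] at h0
  have hsub := ck₁_sub h1 h0
  -- order zero: mean value inequality
  have hmvt : ‖f (Uc x) - f (x 0)‖ ≤ η * (x 0 - Uc x) := by
    refine norm_sub_le_of_deriv_le_Icc (hf.differentiable (by simp)) hUt fun s hs ↦ ?_
    have := hη s hs 1 le_rfl (by norm_num)
    rwa [iteratedDeriv_one] at this
  refine ck_mono (ck_of_ck₁ hsub hmvt) le_rfl (max_le ?_ ?_)
  · nlinarith [pow_nonneg (zero_le_one.trans hD) 3]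
  · have : x 0 - Uc x ≥ 0 := by linarith
    nlinarith [pow_le_pow_left₀ zero_le_one hD 3]


/-! ### The data of one hole: elementary consequences -/

section Data

variable {M a rin : ℝ} {Mf : ℝ → ℝ} {Λ : ℝ → lorentzGroup} {ξ : ℝ → E3} {Uc : E4 → ℝ} {v A σ γ τ₀ : ℝ}

/-- `rin > 0` (it exceeds `r₋ ≥ 0`). [folklore] -/
theorem rin_pos (hsub : Kerr.IsSubextremal M a ∧ Kerr.rMinus M a < rin ∧ rin < Kerr.rPlus M a) : 0 < rin :=
  hsub.1.rMinus_nonneg.trans_lt hsub.2.1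

/-- `γ ≥ 1` (the Lorentz factors are `≥ 1` and `≤ γ`). [folklore] -/
theorem one_le_gamma (hal : ∀ u, (Λ u : E4 ≃L[ℝ] E4) (E4.basisVector 0) =
      ((Λ u : E4 ≃L[ℝ] E4) (E4.basisVector 0)) 0 • E4.ofTimeSpace 1 (deriv ξ u) ∧
      1 ≤ ((Λ u : E4 ≃L[ℝ] E4) (E4.basisVector 0)) 0 ∧ ((Λ u : E4 ≃L[ℝ] E4) (E4.basisVector 0)) 0 ≤ γ) :
    1 ≤ γ := (hal 0).2.1.trans (hal 0).2.2

/-- `A ≥ 0` (it bounds norms). [folklore] -/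
theorem A_nonneg (hgl : ∀ u, (∀ k, 1 ≤ k → k ≤ 5 → ‖iteratedDeriv k ξ u‖ ≤ A) ∧
      ∀ k ≤ 4, ‖iteratedDeriv k (fun t ↦ ((Λ t : E4 ≃L[ℝ] E4) : E4 →L[ℝ] E4)) u‖ ≤ A ∧
        |iteratedDeriv k Mf u| ≤ A) : 0 ≤ A :=
  (norm_nonneg _).trans ((hgl 0).1 1 le_rfl (by norm_num))

/-- `|Mf(u)| ≤ A` (the order-zero global bound). [folklore] -/
theorem abs_mass_le (hgl : ∀ u, (∀ k, 1 ≤ k → k ≤ 5 → ‖iteratedDeriv k ξ u‖ ≤ A) ∧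
      ∀ k ≤ 4, ‖iteratedDeriv k (fun t ↦ ((Λ t : E4 ≃L[ℝ] E4) : E4 →L[ℝ] E4)) u‖ ≤ A ∧
        |iteratedDeriv k Mf u| ≤ A) (u : ℝ) : |Mf u| ≤ A := by
  simpa using ((hgl u).2 0 (Nat.zero_le _)).2

/-! ### Tame sizes of the moduli read on the clock -/

/-- **Tame offset on the clock interval**: for `τ₀ ≤ U ≤ s ≤ t`, `U ≥ 0`, `‖ξ s‖ ≤ s`, the derivatives
of orders `1 … 3` of `b` at `s` are `≤ 4 (C_θ A/U²)(2t + 1 + A)`. [folklore] -/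
theorem tame_restOffset_Icc
    (hsm : ContDiff ℝ ∞ ξ ∧ ContDiff ℝ ∞ (fun t ↦ ((Λ t : E4 ≃L[ℝ] E4) : E4 →L[ℝ] E4)) ∧ ContDiff ℝ ∞ Mf)
    (hal : ∀ u, (Λ u : E4 ≃L[ℝ] E4) (E4.basisVector 0) =
      ((Λ u : E4 ≃L[ℝ] E4) (E4.basisVector 0)) 0 • E4.ofTimeSpace 1 (deriv ξ u) ∧
      1 ≤ ((Λ u : E4 ≃L[ℝ] E4) (E4.basisVector 0)) 0 ∧ ((Λ u : E4 ≃L[ℝ] E4) (E4.basisVector 0)) 0 ≤ γ)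
    (hgl : ∀ u, (∀ k, 1 ≤ k → k ≤ 5 → ‖iteratedDeriv k ξ u‖ ≤ A) ∧
      ∀ k ≤ 4, ‖iteratedDeriv k (fun t ↦ ((Λ t : E4 ≃L[ℝ] E4) : E4 →L[ℝ] E4)) u‖ ≤ A ∧
        |iteratedDeriv k Mf u| ≤ A)
    {Cθ : ℝ} (hCθ0 : 0 ≤ Cθ)
    (hCθ : ∀ (k : ℕ) (u : ℝ),
      ‖iteratedDeriv k (fun t ↦ (((Λ t : E4 ≃L[ℝ] E4).symm : E4 ≃L[ℝ] E4) : E4 →L[ℝ] E4)) u‖ ≤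
        Cθ * ‖iteratedDeriv k (fun t ↦ ((Λ t : E4 ≃L[ℝ] E4) : E4 →L[ℝ] E4)) u‖)
    (hτ₀ : 0 < τ₀)
    (htame : ∀ u, τ₀ ≤ u → ∀ k, 1 ≤ k → k ≤ 4 →
      u ^ 2 * ‖iteratedDeriv k (fun t ↦ ((Λ t : E4 ≃L[ℝ] E4) : E4 →L[ℝ] E4)) u‖ ≤ A)
    {U s t : ℝ} (hU : τ₀ ≤ U) (hs : U ≤ s) (hst : s ≤ t) (hξs : ‖ξ s‖ ≤ s) :
    ∀ k, 1 ≤ k → k ≤ 3 →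
      ‖iteratedDeriv k (fun u ↦ E4.spatial ((Λ u : E4 ≃L[ℝ] E4).symm (E4.ofTimeSpace u (ξ u)))) s‖ ≤
        4 * (Cθ * A / U ^ 2) * (2 * t + 1 + A) := by
  have hA : 0 ≤ A := A_nonneg hgl
  have hθ := tame_theta_Icc hsm.2.1 hCθ0 hCθ hτ₀ hA htame hU hs
  have hb := ck₁_restOffset hsm.2.1 hsm.1 (fun u ↦ (hgl u).1) (fun u ↦ ⟨(hal u).1, (hal u).2.1⟩) hθ
  intro k hk1 hk
  have h := hb.2 k hk1 hk
  rw [norm_iteratedFDeriv_eq_norm_iteratedDeriv] at h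
  refine h.trans (mul_le_mul_of_nonneg_left ?_ (by positivity))
  have hs0 : 0 ≤ s := (hτ₀.le.trans hU).trans hs
  rw [abs_of_nonneg hs0]
  linarith

/-- **The mass defect on the clock is at the monopole rate**: for `U = U x ≥ τ₀`, the map
`y ↦ Mf(U y) − M` has full `C³` size `≤ 6 (A / U^{3/4+σ}) D_U³` at `x`. [folklore] -/
theorem tame_ck_massDefect (hsm : ContDiff ℝ ∞ Mf) (hτ₀ : 0 < τ₀)
    (htame : ∀ u, τ₀ ≤ u → ∀ k ≤ 4, u ^ ((3 : ℝ) / 4 + σ) * |iteratedDeriv k (fun s ↦ Mf s - M) u| ≤ A)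
    {x : E4} {DU : ℝ} (hDU1 : 1 ≤ DU)
    (hUx : ContDiffAt ℝ 3 Uc x ∧ ∀ i, 1 ≤ i → i ≤ 3 → ‖iteratedFDeriv ℝ i Uc x‖ ≤ DU)
    (hU : τ₀ ≤ Uc x) :
    ContDiffAt ℝ 3 (fun y ↦ Mf (Uc y) - M) x ∧
      ∀ i ≤ 3, ‖iteratedFDeriv ℝ i (fun y ↦ Mf (Uc y) - M) x‖ ≤
        6 * (A / Uc x ^ ((3 : ℝ) / 4 + σ)) * DU ^ 3 := by
  have hU0 : 0 < Uc x := hτ₀.trans_le hU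
  have hpow : 0 < Uc x ^ ((3 : ℝ) / 4 + σ) := Real.rpow_pos_of_pos hU0 _
  have hg : ContDiffAt ℝ 3 (fun s ↦ Mf s - M) (Uc x) ∧
      ∀ i ≤ 3, ‖iteratedFDeriv ℝ i (fun s ↦ Mf s - M) (Uc x)‖ ≤ A / Uc x ^ ((3 : ℝ) / 4 + σ) := by
    refine ck_of_iteratedDeriv (n := 3)
      ((hsm.sub contDiff_const).of_le (WithTop.coe_le_coe.mpr le_top)).contDiffAt fun i hi ↦ ?_
    rw [Real.norm_eq_abs, le_div_iff₀ hpow, mul_comm]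
    exact htame _ hU i (by omega)
  have h := ck_comp (g := fun s ↦ Mf s - M) (f := Uc) (x := x) hg hUx
  rw [max_eq_right hDU1, show (Nat.factorial 3 : ℝ) = 6 by norm_num] at h
  exact h

/-- **The frame defect**: `y ↦ Λ(U y)⁻¹ − Λ(y⁰)⁻¹` has full `C³` size `≤ (C_θA/U²)((x⁰ − U) + 12 D_U³)`
at `x` (tameness on `[U, x⁰]`, `OneHole.ck_pathDefect`). [folklore] -/
theorem tame_ck_thetaDefect (hsm : ContDiff ℝ ∞ (fun t ↦ ((Λ t : E4 ≃L[ℝ] E4) : E4 →L[ℝ] E4)))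
    {Cθ : ℝ} (hCθ0 : 0 ≤ Cθ)
    (hCθ : ∀ (k : ℕ) (u : ℝ),
      ‖iteratedDeriv k (fun t ↦ (((Λ t : E4 ≃L[ℝ] E4).symm : E4 ≃L[ℝ] E4) : E4 →L[ℝ] E4)) u‖ ≤
        Cθ * ‖iteratedDeriv k (fun t ↦ ((Λ t : E4 ≃L[ℝ] E4) : E4 →L[ℝ] E4)) u‖)
    (hτ₀ : 0 < τ₀) (hA : 0 ≤ A)
    (htame : ∀ u, τ₀ ≤ u → ∀ k, 1 ≤ k → k ≤ 4 →
      u ^ 2 * ‖iteratedDeriv k (fun t ↦ ((Λ t : E4 ≃L[ℝ] E4) : E4 →L[ℝ] E4)) u‖ ≤ A)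
    {x : E4} {DU : ℝ} (hDU1 : 1 ≤ DU)
    (hUx : ContDiffAt ℝ 3 Uc x ∧ ∀ i, 1 ≤ i → i ≤ 3 → ‖iteratedFDeriv ℝ i Uc x‖ ≤ DU)
    (hU : τ₀ ≤ Uc x) (hUt : Uc x ≤ x 0) :
    ContDiffAt ℝ 3 (fun y ↦ (((Λ (Uc y) : E4 ≃L[ℝ] E4).symm : E4 ≃L[ℝ] E4) : E4 →L[ℝ] E4) -
      (((Λ (y 0) : E4 ≃L[ℝ] E4).symm : E4 ≃L[ℝ] E4) : E4 →L[ℝ] E4)) x ∧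
      ∀ i ≤ 3, ‖iteratedFDeriv ℝ i (fun y ↦ (((Λ (Uc y) : E4 ≃L[ℝ] E4).symm : E4 ≃L[ℝ] E4) : E4 →L[ℝ] E4) -
        (((Λ (y 0) : E4 ≃L[ℝ] E4).symm : E4 ≃L[ℝ] E4) : E4 →L[ℝ] E4)) x‖ ≤
        Cθ * A / Uc x ^ 2 * ((x 0 - Uc x) + 12 * DU ^ 3) :=
  ck_pathDefect (f := fun t ↦ (((Λ t : E4 ≃L[ℝ] E4).symm : E4 ≃L[ℝ] E4) : E4 →L[ℝ] E4))
    (contDiff_theta hsm) hUx hDU1 hUt fun s hs k hk1 hk ↦ by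
      have h := (tame_theta_Icc hsm hCθ0 hCθ hτ₀ hA htame hU hs.1).2 k hk1 (by omega)
      rwa [norm_iteratedFDeriv_eq_norm_iteratedDeriv] at h

/-- **The offset defect**: `y ↦ b(U y) − b(y⁰)` has full `C³` size
`≤ 4 (C_θA/U²)(2x⁰ + 1 + A)((x⁰ − U) + 12 D_U³)` at `x`, if `‖ξ s‖ ≤ s` on `[U, x⁰]`. [folklore] -/
theorem tame_ck_offsetDefect
    (hsm : ContDiff ℝ ∞ ξ ∧ ContDiff ℝ ∞ (fun t ↦ ((Λ t : E4 ≃L[ℝ] E4) : E4 →L[ℝ] E4)) ∧ ContDiff ℝ ∞ Mf)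
    (hal : ∀ u, (Λ u : E4 ≃L[ℝ] E4) (E4.basisVector 0) =
      ((Λ u : E4 ≃L[ℝ] E4) (E4.basisVector 0)) 0 • E4.ofTimeSpace 1 (deriv ξ u) ∧
      1 ≤ ((Λ u : E4 ≃L[ℝ] E4) (E4.basisVector 0)) 0 ∧ ((Λ u : E4 ≃L[ℝ] E4) (E4.basisVector 0)) 0 ≤ γ)
    (hgl : ∀ u, (∀ k, 1 ≤ k → k ≤ 5 → ‖iteratedDeriv k ξ u‖ ≤ A) ∧
      ∀ k ≤ 4, ‖iteratedDeriv k (fun t ↦ ((Λ t : E4 ≃L[ℝ] E4) : E4 →L[ℝ] E4)) u‖ ≤ A ∧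
        |iteratedDeriv k Mf u| ≤ A)
    {Cθ : ℝ} (hCθ0 : 0 ≤ Cθ)
    (hCθ : ∀ (k : ℕ) (u : ℝ),
      ‖iteratedDeriv k (fun t ↦ (((Λ t : E4 ≃L[ℝ] E4).symm : E4 ≃L[ℝ] E4) : E4 →L[ℝ] E4)) u‖ ≤
        Cθ * ‖iteratedDeriv k (fun t ↦ ((Λ t : E4 ≃L[ℝ] E4) : E4 →L[ℝ] E4)) u‖)
    (hτ₀ : 0 < τ₀)
    (htame : ∀ u, τ₀ ≤ u → ∀ k, 1 ≤ k → k ≤ 4 →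
      u ^ 2 * ‖iteratedDeriv k (fun t ↦ ((Λ t : E4 ≃L[ℝ] E4) : E4 →L[ℝ] E4)) u‖ ≤ A)
    {x : E4} {DU : ℝ} (hDU1 : 1 ≤ DU)
    (hUx : ContDiffAt ℝ 3 Uc x ∧ ∀ i, 1 ≤ i → i ≤ 3 → ‖iteratedFDeriv ℝ i Uc x‖ ≤ DU)
    (hU : τ₀ ≤ Uc x) (hUt : Uc x ≤ x 0) (hξI : ∀ s ∈ Icc (Uc x) (x 0), ‖ξ s‖ ≤ s) :
    ContDiffAt ℝ 3 (fun y ↦ E4.spatial ((Λ (Uc y) : E4 ≃L[ℝ] E4).symm (E4.ofTimeSpace (Uc y) (ξ (Uc y)))) -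
      E4.spatial ((Λ (y 0) : E4 ≃L[ℝ] E4).symm (E4.ofTimeSpace (y 0) (ξ (y 0))))) x ∧
      ∀ i ≤ 3, ‖iteratedFDeriv ℝ i (fun y ↦
        E4.spatial ((Λ (Uc y) : E4 ≃L[ℝ] E4).symm (E4.ofTimeSpace (Uc y) (ξ (Uc y)))) -
          E4.spatial ((Λ (y 0) : E4 ≃L[ℝ] E4).symm (E4.ofTimeSpace (y 0) (ξ (y 0))))) x‖ ≤
        4 * (Cθ * A / Uc x ^ 2) * (2 * x 0 + 1 + A) * ((x 0 - Uc x) + 12 * DU ^ 3) :=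
  ck_pathDefect (f := fun u ↦ E4.spatial ((Λ u : E4 ≃L[ℝ] E4).symm (E4.ofTimeSpace u (ξ u))))
    (contDiff_restOffset hsm.2.1 hsm.1) hUx hDU1 hUt fun s hs k hk1 hk ↦
      tame_restOffset_Icc hsm hal hgl hCθ0 hCθ hτ₀ htame hU hs.1 hs.2 (hξI s hs) k hk1 hk

end Data

end OneHole

/-- Registered sub-goal form (stub `oneHole_norm_sub_le_of_deriv_le_Icc` of the crux item) of
`OneHole.norm_sub_le_of_deriv_le_Icc`: the mean value inequality along the clock interval. [folklore] -/
theorem oneHole_norm_sub_le_of_deriv_le_Icc : ∀ {F : Type*} [NormedAddCommGroup F] [NormedSpace ℝ F] {f : ℝ → F}, Differentiable ℝ f → ∀ {U t C : ℝ}, U ≤ t → (∀ s ∈ Set.Icc U t, ‖deriv f s‖ ≤ C) → ‖f U - f t‖ ≤ C * (t - U) :=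
  fun hf _ _ _ hUt h ↦ OneHole.norm_sub_le_of_deriv_le_Icc hf hUt h

end Summit.FinalStateConjecture.FinalStateConjecture.Theorems

end
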